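import Literature.MathematicalPhysics.QuantumFieldTheory.Federbush1986.PeelingEstimate
import Literature.MathematicalPhysics.QuantumFieldTheory.Federbush1986.SimplyConnectedBoxMinusBox

/-!
# Federbush [F3] §5.3 3) p. 303 ON THE NICE BLOCK: «We assign ε to a sufficient number of additional bonds to define an axial gauge
# in each nice block» — the extended axial gauge of a punctured block (comb bonds outside the hole + connectors over its shadow)
# IS a gauge and is PEELABLE, hence the Observation p. 303 holds on the nice block for EVERY group

statement-level skeleton of published theorems with citation tags; proofs where landed; nothing here is a claim about the Yang–Mills mass gap

SOURCE. [Federbush1987PhaseCellIII] P. Federbush, *A phase cell approach to Yang–Mills theory III. Local stability, modified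
renormalization group transformation*, Commun. Math. Phys. **110** (1987) 293–309, §5.3 1)–3) p. 303 (held `paper:url-4700a514f365`,
PDF p. 11; r17's render `…/renders/fed1987III/fed1987-cmp110-III-p011-x2.png`): *«1) … Inside each N⁴ block, the vertices and bonds not
in any of the balls includes a large connected set of bonds and vertices, the major block sublattice. … 2) We will say a lattice is
simply connected if every closed contour can be modified to a trivial contour (a point) by a sequence of elementary homotopies. … By
removing ≦ c₄ vertices and bonds each major block sublattice and the major sublattice may be made simply connected and connected. (This
could not be done in two dimensions.) We thus arrive at the nice block sublattices and nice sublattice.  Observation. In a simply connected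
lattice, if the bonds in a maximal tree are assigned the identity as a choice of gauge, then the bond variables are uniquely determined by
the plaquette variables.  3) The bonds assigned ε inside a block in the Balaban axial gauge will also be assigned ε in the nice block
sublattice. This in general will not define a gauge inside the nice block. We assign ε to a sufficient number of additional bonds to
define an axial gauge in each nice block.»*

CITATION HEADER (lean-in-tree rule).  lit-balaban cell (HOME `run/shared/lean/pub/lit-balaban/`), Phase-2 proof seat p26 (gen 11;
free-target protocol G.5-34(d), TAKING HOME/STATUS 2026-08-22T02:48Z), SKELETON row **F3.Eq5.26-5.40** (§5.3; owner r17, referee ref-5,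
head `absent`).  THE MODEL OF THE NICE BLOCK is p32's (gen 10, `SimplyConnectedBoxMinusBox`, p311452): the block `[lo, hi] ⊂ ℤ^d` with an
interior box `K = [klo, khi]` removed (`lo < klo ≦ khi < hi` coordinatewise) — bonds `puncturedBonds` (both endpoints off `K`), plaquettes
`puncturedPlaq` (all four corners off `K`); p32 proved it simply connected for `d ≧ 3` (whence, by `SimplyConnectedObservation`, the
flat / abelian / linearised Observation there for EVERY spanning tree).  THIS FILE does step 3) on that model LITERALLY and gets the
Observation there for EVERY GROUP: fifth file of this seat's Observation thread (`ObservationNonabelianWitness` p310996,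
`CombGaugeObservation` p312224, `ObservationNonabelianEmbeddings` p312960/p313788, `PeelingObservation` p313427/p314483 — whose criterion
`Peeling.eq_of_plaq_eq` is the engine here —, `PeelingEstimate` p315145).  RELATION TO p32's `NiceBlockAxialGauge` (p315329, same
step 3)): that file proves, for EVERY finite sublattice connected from a base point, the EXISTENCE of a maximal tree grown leaf by leaf
(optionally extending prescribed bonds) with a based gauge transformation to `ε` on it — whence the Observation there in the flat /
abelian / linearised forms of `SimplyConnectedObservation`; for a general group an arbitrary maximal tree does NOT determine the bond
variables (`ObservationNonabelianWitness`, `PeelingObservation.isEmpty_peeling_treeT`).  THIS file exhibits, for the punctured block, ONE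
EXPLICIT extension of the surviving comb which is PEELABLE, so that the bond variables ARE determined for every group.  Companions BY
NAME, none edited.

WHAT IS PROVED (dimension `n + 3`, i.e. every `d ≧ 3` — «(This could not be done in two dimensions.)» —, directions `e_0, e_1, e_τ`,
`τ = n + 2` the vertical = last leg of the comb contours `Γ_{lo,x}` of `CombGaugeObservation` (first `e_0`, …, last `e_τ`); the hole
`K = [klo, khi]` interior; EVERY group `G`):
* §2 `ColK klo khi x` (`x̄ ∈ K̄`: the column of `x` meets `K`), `mem_hole_iff`, `sides_mem_puncturedBonds` (the four sides of an admissible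
  plaquette are bonds of the punctured block).
* §3 **`niceTree lo hi klo khi`** — THE EXTENDED AXIAL GAUGE of step 3): the comb bonds lying in the punctured block («will also be
  assigned ε in the nice block sublattice»; what is lost are the vertical comb bonds through `K`, which disconnects the SHADOW
  `{x̄ ∈ K̄, x_τ > khi_τ}` from the corner — «This in general will not define a gauge inside the nice block») together with the CONNECTORS
  `IsConn`: the `e_0`-bonds `⟨y − e_0, y⟩` entering the sites `y` of the first shadow layer (`ȳ ∈ K̄`, `y_τ = khi_τ + 1`) («We assign ε to a
  sufficient number of additional bonds»).  The two kinds of bonds whose comb plaquette dips into `K`: `IsBadA` (horizontal, not along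
  `e_0`, in the first shadow layer, touching the shadow), `IsBadB` (along `e_0`, leaving the first shadow layer to the `+e_0` side).
* §4 the elimination order `niceRank = (3D+3)·(level above lo) + sec`, `sec` = comb height for plain bonds, `D + 1 + x_0` for the first kind,
  `2D + 2 + x_1` for the second (`D = Σ_i (hi_i − lo_i)` bounds all heights and offsets: `height_le_Dsum`, `sec_lt_Msl`).
* §5 the attached plaquettes and the peeling conditions kind by kind: first kind ↦ `(x − e_0; μ, 0)` (`plaqA_mem`, `lowerA`: its other
  sides are connectors, first-kind bonds one step to `−e_0`, or plain bonds of the layer); second kind ↦ `(x − e_1; 0, 1)` — the third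
  direction `e_1` is where `d ≧ 3` enters (`plaqB_mem`, `lowerB`); plain bonds ↦ the comb plaquette `(x − e_ν; μ, ν)`, which stays off `K`
  BECAUSE the bond is of neither kind nor a connector (`plaqC_mem`, `lowerC`).
* §6 **`nicePeeling hK : Peeling (puncturedPlaq lo hi klo khi) (puncturedBonds lo hi klo khi) (niceTree lo hi klo khi)`** and, by
  `Peeling.eq_of_plaq_eq`, **`eq_of_plaq_eq_of_niceGauge`**: two `G`-configurations equal to `ε` on the extended axial gauge with the same
  plaquette variables on the punctured block agree on the punctured block — THE OBSERVATION ON THE NICE BLOCK FOR EVERY GROUP (abelian or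
  not; cf. `ObservationNonabelianWitness`: false for arbitrary maximal trees); `eq_one_of_flat_of_niceGauge`, `mem_closure_plaq_of_niceGauge`.
* §7 **it IS a gauge** («to define an axial gauge»): `niceFn` = the comb gauge function followed by the SHADOW gauge function `shadowFn`
  (on the shadow, the contour variable of the connector chain of the column; constant up each column), **`gaugeAct_niceFn_eq_one`** /
  **`exists_niceGauge`**: every configuration of every group is carried by a based gauge transformation to one equal to `ε` on all of
  `niceTree` (so the gauge bonds carry no closed-contour constraint), plaquette variables transforming by conjugation;
  `observation_niceGauge_orbit` (the Observation for two arbitrary configurations after this gauge fixing).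
* §8 `observation_puncturedBlock` — the same packaged for p32's convention `d`, `3 ≦ d`.
* §9 (v1.1) IT IS A MAXIMAL TREE: `nicePath` (the gauge contour of a site: comb contour, connector chain, straight up the column),
  `combPath_mem_punctured`, `nicePath_subset`, **`spans_niceTree`** (p32's `Spans`: the gauge bonds reach every endpoint of every bond of
  the punctured block from the corner), whence the COMPLETE GAUGE FIXING `niceGauge_unique` / `gaugeAct_eq_of_niceGauge` (two based gauge
  transformations to `ε` on the gauge bonds agree on the punctured block).
* §10 (v1.1) **`dist_le_of_niceGauge`** / `absG_le_of_niceGauge`: on the nice block the bond variables are LIPSCHITZ in the plaquette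
  variables for every group with a bi-invariant metric (constant `(3^{niceRank+1} − 1)/2`, `PeelingEstimate.Peeling.dist_le_pow_rank`) —
  step 5)'s «In this gauge we deduce an inequality like (5.24)» at the group level, globally.

HONEST SCOPE.  (a) The nice block is MODELLED, as in p32's file, by a box minus ONE interior box (print removes `≦ r₁` balls and `≦ c₄`
further vertices/bonds per block; several disjoint holes whose shadows and first layers do not interact would peel the same way, hole by
hole — not formalised).  (b) Print's «axial gauge in each nice block» is not spelled out; the connectors along `e_0` are ONE explicit choice
of the «additional bonds» (any choice making the gauge bonds a maximal tree with a peeling would do; an arbitrary maximal tree would NOT,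
`PeelingObservation.isEmpty_peeling_treeT`).  (c) (v1: uniqueness of the based gauge transformation was left out; v1.1 §9 proves it —
spanning + `niceGauge_unique`.)  (d) §10's Lipschitz constant is exponential in the rank (a crude but explicit block-dependent constant;
print's (5.24) is a finer, second-order statement at the Lie-algebra level, p32's `AxialGaugeEq524*`).  Definitions with bodies only
(`ColK`, `IsConn`, `IsBadA`, `IsBadB`, `niceTree`, `Dsum`, `Msl`, `sec`, `niceRank`, `nicePlaq`, `nicePeeling`, `connBase`, `connLen`,
`shadowFn`, `niceFn`, `nicePath` + decidability instances); everything else is a theorem; no `sorry`, no new named facts, axioms standard.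
Unit `lit-balaban-p26` (literature-prover-lit-balaban-p26-g11-0).

Versions: v1 p315721 (§1–§8); v1.1 (this text) = v1 unchanged + §9–§10 (and the import of `PeelingEstimate`, which imports
`PeelingObservation`).
-/

namespace Literature.MathematicalPhysics.QuantumFieldTheory.Federbush1986

namespace PuncturedBlockPeeling

open LatticeContour SimplyConnectedBox CombGaugeObservation PeelingObservation SimplyConnectedBoxMinusBox

open scoped BigOperators

variable {n : ℕ}

/-! ## §1 Directions `e_0, e_1, e_τ` of `ℤ^{n+3}` and coordinates of shifted sites -/

section Fin

/-- `e_0 ≠ e_τ` in dimension `≥ 3`. [cite: Federbush1987PhaseCellIII, §5.3 2) p. 303] -/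
theorem zero_ne_top : (0 : Fin (n + 3)) ≠ (Fin.last (n + 2)) := fun h => by
  have := congrArg Fin.val h
  simp at this

/-- `e_1 ≠ e_τ` in dimension `≥ 3` («This could not be done in two dimensions.»). [cite: Federbush1987PhaseCellIII, §5.3 2) p. 303] -/
theorem one_ne_top : (1 : Fin (n + 3)) ≠ (Fin.last (n + 2)) := fun h => by
  have := congrArg Fin.val h
  rw [Fin.val_one, Fin.val_last] at this
  omega

/-- A direction other than `e_τ` comes before it. [cite: Federbush1987PhaseCellIII, §5.3 2) p. 303] -/
theorem lt_top_of_ne {μ : Fin (n + 3)} (h : μ ≠ (Fin.last (n + 2))) : μ < (Fin.last (n + 2)) := Fin.lt_last_iff_ne_last.2 h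

end Fin

section Coord

variable {d : ℕ}

/-- `(x + e_μ)_μ = x_μ + 1`. [cite: Federbush1987PhaseCellIII, §5.1 p. 300] -/
theorem addE_self (x : Site d) (μ : Fin d) : (x + ev μ) μ = x μ + 1 := by rw [add_ev_apply, if_pos rfl]

/-- `(x + e_μ)_i = x_i` for `i ≠ μ`. [cite: Federbush1987PhaseCellIII, §5.1 p. 300] -/
theorem addE_ne (x : Site d) {μ i : Fin d} (h : i ≠ μ) : (x + ev μ) i = x i := by rw [add_ev_apply, if_neg h, add_zero]

/-- `(x − e_μ)_μ = x_μ − 1`. [cite: Federbush1987PhaseCellIII, §5.1 p. 300] -/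
theorem subE_self (x : Site d) (μ : Fin d) : (x - ev μ) μ = x μ - 1 := by rw [sub_ev_apply, if_pos rfl]

/-- `(x − e_μ)_i = x_i` for `i ≠ μ`. [cite: Federbush1987PhaseCellIII, §5.1 p. 300] -/
theorem subE_ne (x : Site d) {μ i : Fin d} (h : i ≠ μ) : (x - ev μ) i = x i := by rw [sub_ev_apply, if_neg h, sub_zero]

/-- `x − e_ν + e_μ + e_ν = x + e_μ`. [cite: Federbush1987PhaseCellIII, §5.1 p. 300] -/
theorem sub_add_add_ev (x : Site d) (μ ν : Fin d) : x - ev ν + ev μ + ev ν = x + ev μ := by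
  rw [add_right_comm, sub_ev_add_ev]

end Coord

/-! ## §2 The hole `K = [klo, khi]`, the columns over it, the punctured block -/

section Hole

variable {lo hi klo khi : Site (n + 3)}

/-- `x̄ ∈ K̄`: the vertical line through `x` meets the removed box `K = [klo, khi]` (all coordinates but the last lie in `K`'s range).
[cite: Federbush1987PhaseCellIII, §5.3 1)–3) p. 303] -/
def ColK (klo khi x : Site (n + 3)) : Prop := ∀ i : Fin (n + 3), i ≠ (Fin.last (n + 2)) → klo i ≤ x i ∧ x i ≤ khi i

/-- `ColK` is decidable (finitely many integer comparisons). [cite: Federbush1987PhaseCellIII, §5.3 1) p. 303] -/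
instance instDecColK (klo khi x : Site (n + 3)) : Decidable (ColK klo khi x) := by unfold ColK; infer_instance

/-- Membership in the hole = column condition + vertical range. [cite: Federbush1987PhaseCellIII, §5.3 1) p. 303] -/
theorem mem_hole_iff {x : Site (n + 3)} : x ∈ boxSites klo khi ↔ ColK klo khi x ∧ klo (Fin.last (n + 2)) ≤ x (Fin.last (n + 2)) ∧ x (Fin.last (n + 2)) ≤ khi (Fin.last (n + 2)) := by
  rw [mem_boxSites]
  constructor
  · intro h; exact ⟨fun i _ => h i, (h _).1, (h _).2⟩
  · rintro ⟨h, h1, h2⟩ i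
    by_cases hi : i = (Fin.last (n + 2))
    · rw [hi]; exact ⟨h1, h2⟩
    · exact h i hi

/-- A site above the hole is not in it. [cite: Federbush1987PhaseCellIII, §5.3 1) p. 303] -/
theorem not_mem_hole_of_gt {x : Site (n + 3)} (h : khi (Fin.last (n + 2)) < x (Fin.last (n + 2))) : x ∉ boxSites klo khi := fun hx => by
  have := (mem_hole_iff.1 hx).2.2; omega

/-- A site below the hole is not in it. [cite: Federbush1987PhaseCellIII, §5.3 1) p. 303] -/
theorem not_mem_hole_of_lt {x : Site (n + 3)} (h : x (Fin.last (n + 2)) < klo (Fin.last (n + 2))) : x ∉ boxSites klo khi := fun hx => by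
  have := (mem_hole_iff.1 hx).2.1; omega

/-- The column condition only sees the horizontal coordinates. [cite: Federbush1987PhaseCellIII, §5.3 1) p. 303] -/
theorem colK_congr {x y : Site (n + 3)} (h : ∀ i, i ≠ (Fin.last (n + 2)) → y i = x i) : ColK klo khi y ↔ ColK klo khi x := by
  unfold ColK
  exact forall₂_congr fun i hi => by rw [h i hi]

/-- Changing one horizontal coordinate inside `K`'s range keeps the column over the hole. [cite: Federbush1987PhaseCellIII, §5.3 1) p. 303] -/
theorem colK_of_eq_off {x y : Site (n + 3)} {μ : Fin (n + 3)} (hxy : ∀ i, i ≠ (Fin.last (n + 2)) → i ≠ μ → y i = x i)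
    (hx : ColK klo khi x) (hyμ : klo μ ≤ y μ ∧ y μ ≤ khi μ) : ColK klo khi y := by
  intro i hi
  by_cases hiμ : i = μ
  · rw [hiμ]; exact hyμ
  · rw [hxy i hi hiμ]; exact hx i hi

/-- `x̄ ∈ K̄`, `x̄ + ē_μ ∉ K̄` ⇒ `x_μ = khi_μ`. [cite: Federbush1987PhaseCellIII, §5.3 1) p. 303] -/
theorem coord_eq_khi {x : Site (n + 3)} {μ : Fin (n + 3)} (hμ : μ ≠ (Fin.last (n + 2))) (hx : ColK klo khi x)
    (hx' : ¬ ColK klo khi (x + ev μ)) : x μ = khi μ := by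
  by_contra hne
  have h1 := hx μ hμ
  exact hx' (colK_of_eq_off (μ := μ) (fun i _ hiμ => addE_ne x hiμ) hx (by rw [addE_self]; omega))

/-- `x̄ ∉ K̄`, `x̄ + ē_μ ∈ K̄` ⇒ `x_μ + 1 = klo_μ`. [cite: Federbush1987PhaseCellIII, §5.3 1) p. 303] -/
theorem coord_eq_klo {x : Site (n + 3)} {μ : Fin (n + 3)} (hμ : μ ≠ (Fin.last (n + 2))) (hx' : ColK klo khi (x + ev μ))
    (hx : ¬ ColK klo khi x) : x μ + 1 = klo μ := by
  by_contra hne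
  have h1 := hx' μ hμ
  rw [addE_self] at h1
  exact hx (colK_of_eq_off (x := x + ev μ) (μ := μ) (fun i _ hiμ => (addE_ne x hiμ).symm) hx' (by omega))

/-- The four corners of an admissible plaquette are in the box, so its four sides are bonds of the punctured block.
[cite: Federbush1987PhaseCellIII, §5.3 1)–2) p. 303] -/
theorem sides_mem_puncturedBonds {p : LatticeContour.Plaq (n + 3)} (hp : p ∈ puncturedPlaq lo hi klo khi) :
    ∀ l ∈ plaqLoop p.1 p.2.1 p.2.2, l.1 ∈ puncturedBonds lo hi klo khi := by
  obtain ⟨z, μ, ν⟩ := p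
  obtain ⟨⟨-, hz, hzz⟩, h1, h2, h3, h4⟩ := hp
  dsimp only at hz hzz h1 h2 h3 h4 ⊢
  have hzμ : z + ev μ ∈ boxSites lo hi := mem_boxSites_of_between hz hzz fun i => by
    rw [add_ev_apply, add_ev_apply, add_ev_apply]; split_ifs <;> omega
  have hzν : z + ev ν ∈ boxSites lo hi := mem_boxSites_of_between hz hzz fun i => by
    rw [add_ev_apply, add_ev_apply, add_ev_apply]; split_ifs <;> omega
  intro l hl
  rcases mem_plaqLoop_iff.1 ⟨l, hl, rfl⟩ with h | h | h | h <;> rw [h]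
  · exact ⟨⟨hz, hzμ⟩, h1, h2⟩
  · exact ⟨⟨hzμ, hzz⟩, h2, h4⟩
  · refine ⟨⟨hzν, ?_⟩, h3, ?_⟩ <;> rw [add_right_comm] <;> assumption
  · exact ⟨⟨hz, hzν⟩, h1, h3⟩

end Hole

/-! ## §3 Step 3): comb bonds outside the hole + connectors = the extended axial gauge; the three kinds of non-tree bonds -/

section Tree

variable {lo hi klo khi : Site (n + 3)}

/-- CONNECTORS: the bonds `⟨y − e_0, y⟩` entering, along `e_0`, the sites `y` of the first layer of the hole's SHADOW (`ȳ ∈ K̄`,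
`y_τ = khi_τ + 1`) — «We assign ε to a sufficient number of additional bonds». [cite: Federbush1987PhaseCellIII, §5.3 3) p. 303] -/
def IsConn (klo khi : Site (n + 3)) (b : Bond (n + 3)) : Prop :=
  b.2 = 0 ∧ b.1 (Fin.last (n + 2)) = khi (Fin.last (n + 2)) + 1 ∧ ColK klo khi (b.1 + ev 0)

/-- Non-tree bonds of the FIRST KIND: horizontal, not along `e_0`, in the first shadow layer, touching the shadow (their comb plaquette
dips into the hole). [cite: Federbush1987PhaseCellIII, §5.3 3) p. 303] -/
def IsBadA (klo khi : Site (n + 3)) (b : Bond (n + 3)) : Prop :=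
  b.2 ≠ 0 ∧ b.2 ≠ (Fin.last (n + 2)) ∧ b.1 (Fin.last (n + 2)) = khi (Fin.last (n + 2)) + 1 ∧ (ColK klo khi b.1 ∨ ColK klo khi (b.1 + ev b.2))

/-- Non-tree bonds of the SECOND KIND: along `e_0`, in the first shadow layer, leaving the shadow. [cite: Federbush1987PhaseCellIII, §5.3 3) p. 303] -/
def IsBadB (klo khi : Site (n + 3)) (b : Bond (n + 3)) : Prop :=
  b.2 = 0 ∧ b.1 (Fin.last (n + 2)) = khi (Fin.last (n + 2)) + 1 ∧ ColK klo khi b.1 ∧ ¬ ColK klo khi (b.1 + ev 0)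

/-- Decidability of `IsConn`. [cite: Federbush1987PhaseCellIII, §5.3 3) p. 303] -/
instance instDecIsConn (klo khi : Site (n + 3)) (b : Bond (n + 3)) : Decidable (IsConn klo khi b) := by
  unfold IsConn; infer_instance

/-- Decidability of `IsBadA`. [cite: Federbush1987PhaseCellIII, §5.3 3) p. 303] -/
instance instDecIsBadA (klo khi : Site (n + 3)) (b : Bond (n + 3)) : Decidable (IsBadA klo khi b) := by
  unfold IsBadA; infer_instance

/-- Decidability of `IsBadB`. [cite: Federbush1987PhaseCellIII, §5.3 3) p. 303] -/
instance instDecIsBadB (klo khi : Site (n + 3)) (b : Bond (n + 3)) : Decidable (IsBadB klo khi b) := by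
  unfold IsBadB; infer_instance

/-- THE EXTENDED AXIAL GAUGE of the punctured block `[lo, hi] ∖ [klo, khi]`: «The bonds assigned ε inside a block in the Balaban axial
gauge will also be assigned ε in the nice block sublattice» (the comb bonds lying in the punctured block) «… We assign ε to a
sufficient number of additional bonds to define an axial gauge in each nice block» (the connectors).
[cite: Federbush1987PhaseCellIII, §5.3 3) p. 303] -/
def niceTree (lo hi klo khi : Site (n + 3)) : Set (Bond (n + 3)) :=
  {b | b ∈ puncturedBonds lo hi klo khi ∧ (b ∈ combTree lo hi ∨ IsConn klo khi b)}

/-- The gauge bonds lie in the punctured block. [cite: Federbush1987PhaseCellIII, §5.3 3) p. 303] -/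
theorem niceTree_subset : niceTree lo hi klo khi ⊆ puncturedBonds lo hi klo khi := fun _ h => h.1

/-- The comb bonds of the punctured block are gauge bonds («will also be assigned ε in the nice block sublattice»).
[cite: Federbush1987PhaseCellIII, §5.3 3) p. 303] -/
theorem comb_mem_niceTree {b : Bond (n + 3)} (hb : b ∈ puncturedBonds lo hi klo khi) (hc : b ∈ combTree lo hi) :
    b ∈ niceTree lo hi klo khi := ⟨hb, Or.inl hc⟩

/-- Connectors in the punctured block are gauge bonds. [cite: Federbush1987PhaseCellIII, §5.3 3) p. 303] -/
theorem conn_mem_niceTree {b : Bond (n + 3)} (hb : b ∈ puncturedBonds lo hi klo khi) (hc : IsConn klo khi b) :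
    b ∈ niceTree lo hi klo khi := ⟨hb, Or.inr hc⟩

end Tree

/-! ## §4 The elimination rank: level first, then kind, then position -/

section Rank

variable {lo hi klo khi : Site (n + 3)}

/-- `D = Σ_i (hi_i − lo_i)`: a bound for every height and every coordinate offset in the box. [cite: Federbush1987PhaseCellIII, §5.3 1) p. 303] -/
def Dsum (lo hi : Site (n + 3)) : ℕ := ∑ i, (hi i - lo i).toNat

/-- The level multiplier `M = 3D + 3` (exceeds every secondary rank). [cite: Federbush1987PhaseCellIII, §5.3 3) p. 303] -/
def Msl (lo hi : Site (n + 3)) : ℕ := 3 * Dsum lo hi + 3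

/-- Secondary rank: first-kind bonds by their `e_0`-coordinate (above every height), second-kind bonds by their `e_1`-coordinate
(above every first-kind rank), all other bonds by their comb height. [cite: Federbush1987PhaseCellIII, §5.3 3) p. 303] -/
def sec (lo hi klo khi : Site (n + 3)) (b : Bond (n + 3)) : ℕ :=
  if IsBadA klo khi b then Dsum lo hi + 1 + (b.1 0 - lo 0).toNat
  else if IsBadB klo khi b then 2 * Dsum lo hi + 2 + (b.1 1 - lo 1).toNat
  else height lo b

/-- THE RANK: `M · (level above lo) + secondary rank`. [cite: Federbush1987PhaseCellIII, §5.3 3) p. 303] -/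
def niceRank (lo hi klo khi : Site (n + 3)) (b : Bond (n + 3)) : ℕ :=
  Msl lo hi * (b.1 (Fin.last (n + 2)) - lo (Fin.last (n + 2))).toNat + sec lo hi klo khi b

/-- A coordinate offset in the box is at most `D`. [cite: Federbush1987PhaseCellIII, §5.3 1) p. 303] -/
theorem toNat_le_Dsum {x : Site (n + 3)} (hx : x ∈ boxSites lo hi) (i : Fin (n + 3)) : (x i - lo i).toNat ≤ Dsum lo hi := by
  have h1 : (x i - lo i).toNat ≤ (hi i - lo i).toNat :=
    Int.toNat_le_toNat (by have := (mem_boxSites.1 hx i).2; omega)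
  exact h1.trans (Finset.single_le_sum (f := fun i => (hi i - lo i).toNat) (fun _ _ => Nat.zero_le _) (Finset.mem_univ i))

/-- A height in the box is at most `D`. [cite: Federbush1987PhaseCellIII, §5.3 2)–3) p. 303] -/
theorem height_le_Dsum {b : Bond (n + 3)} (hb : b ∈ boxBonds lo hi) : height lo b ≤ Dsum lo hi := by
  unfold height Dsum
  refine Finset.sum_le_sum fun ν _ => ?_
  have hx := mem_boxSites.1 (mem_boxBonds.1 hb).1 ν
  by_cases hν : b.2 < ν
  · rw [if_pos hν]; exact Int.toNat_le_toNat (by omega)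
  · rw [if_neg hν]; exact Nat.zero_le _

/-- Every secondary rank is below the level multiplier. [cite: Federbush1987PhaseCellIII, §5.3 3) p. 303] -/
theorem sec_lt_Msl {b : Bond (n + 3)} (hb : b ∈ boxBonds lo hi) : sec lo hi klo khi b < Msl lo hi := by
  unfold sec Msl
  split_ifs
  · have := toNat_le_Dsum (mem_boxBonds.1 hb).1 0; omega
  · have := toNat_le_Dsum (mem_boxBonds.1 hb).1 1; omega
  · have := height_le_Dsum hb; omega

/-- Same level, smaller secondary rank ⇒ smaller rank. [cite: Federbush1987PhaseCellIII, §5.3 3) p. 303] -/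
theorem rank_lt_of_sec_lt {s b : Bond (n + 3)} (hlev : s.1 (Fin.last (n + 2)) = b.1 (Fin.last (n + 2)))
    (h : sec lo hi klo khi s < sec lo hi klo khi b) : niceRank lo hi klo khi s < niceRank lo hi klo khi b := by
  unfold niceRank; rw [hlev]; omega

/-- One level lower ⇒ smaller rank. [cite: Federbush1987PhaseCellIII, §5.3 3) p. 303] -/
theorem rank_lt_of_level {s b : Bond (n + 3)} (hs : s ∈ boxBonds lo hi) (hlev : s.1 (Fin.last (n + 2)) + 1 = b.1 (Fin.last (n + 2))) (hlo : lo (Fin.last (n + 2)) ≤ s.1 (Fin.last (n + 2))) :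
    niceRank lo hi klo khi s < niceRank lo hi klo khi b := by
  have h1 := sec_lt_Msl (klo := klo) (khi := khi) hs
  have h2 : (b.1 (Fin.last (n + 2)) - lo (Fin.last (n + 2))).toNat = (s.1 (Fin.last (n + 2)) - lo (Fin.last (n + 2))).toNat + 1 := by omega
  unfold niceRank
  rw [h2, Nat.mul_add, mul_one]
  omega

end Rank

/-! ## §5 The attached plaquettes and the peeling conditions, kind by kind -/

section Cases

variable {lo hi klo khi : Site (n + 3)} (hK : ∀ i, lo i < klo i ∧ klo i ≤ khi i ∧ khi i < hi i)
include hK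

/-- FIRST KIND, the attached plaquette `(x − e_0; μ, 0)` (to the `−e_0` side of the bond, inside the shadow layer) is admissible.
[cite: Federbush1987PhaseCellIII, §5.3 2)–3) p. 303] -/
theorem plaqA_mem {x : Site (n + 3)} {μ : Fin (n + 3)} (hb : ((x, μ) : Bond (n + 3)) ∈ puncturedBonds lo hi klo khi)
    (hA : IsBadA klo khi (x, μ)) : ((x - ev 0, μ, (0 : Fin (n + 3))) : LatticeContour.Plaq (n + 3)) ∈ puncturedPlaq lo hi klo khi := by
  obtain ⟨⟨hx, hxμ⟩, -, -⟩ := hb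
  obtain ⟨hμ0, hμτ, hlev, hcol⟩ := hA
  dsimp only at hx hxμ hμ0 hμτ hlev hcol
  have hx0 : klo 0 ≤ x 0 := by
    rcases hcol with h | h
    · exact (h 0 zero_ne_top).1
    · have := (h 0 zero_ne_top).1; rwa [addE_ne x (Ne.symm hμ0)] at this
  have hK0 := hK 0
  have hxm : x - ev 0 ∈ boxSites lo hi := by
    rw [mem_boxSites] at hx ⊢
    intro i
    by_cases hi : i = 0
    · rw [hi, subE_self]; have := hx 0; omega
    · rw [subE_ne x hi]; exact hx i
  have hl1 : (x - ev 0 : Site (n + 3)) (Fin.last (n + 2)) = khi (Fin.last (n + 2)) + 1 := by rw [subE_ne x zero_ne_top.symm, hlev]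
  have hl2 : (x - ev 0 + ev μ : Site (n + 3)) (Fin.last (n + 2)) = khi (Fin.last (n + 2)) + 1 := by rw [addE_ne _ (Ne.symm hμτ), hl1]
  have hl4 : (x + ev μ : Site (n + 3)) (Fin.last (n + 2)) = khi (Fin.last (n + 2)) + 1 := by rw [addE_ne _ (Ne.symm hμτ), hlev]
  refine ⟨⟨hμ0, hxm, by rw [sub_add_add_ev]; exact hxμ⟩, ?_, ?_, ?_, ?_⟩ <;> dsimp only
  · exact not_mem_hole_of_gt (by omega)
  · exact not_mem_hole_of_gt (by omega)
  · rw [sub_ev_add_ev]; exact not_mem_hole_of_gt (by omega)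
  · rw [sub_add_add_ev]; exact not_mem_hole_of_gt (by omega)

/-- FIRST KIND, peeling condition: the other three sides of `(x − e_0; μ, 0)` are connectors or bonds of smaller rank (first kind one step
to `−e_0`, or plain bonds of the layer). [cite: Federbush1987PhaseCellIII, §5.3 2)–3) p. 303] -/
theorem lowerA {x : Site (n + 3)} {μ : Fin (n + 3)} (hb : ((x, μ) : Bond (n + 3)) ∈ puncturedBonds lo hi klo khi)
    (hA : IsBadA klo khi (x, μ)) :
    ∀ l ∈ plaqLoop (x - ev 0) μ 0, l.1 ≠ (x, μ) →
      l.1 ∈ niceTree lo hi klo khi ∨ (l.1 ∈ puncturedBonds lo hi klo khi ∧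
        niceRank lo hi klo khi l.1 < niceRank lo hi klo khi (x, μ)) := by
  have hp := plaqA_mem hK hb hA
  obtain ⟨hμ0, hμτ, hlev, hcol⟩ := hA
  dsimp only at hμ0 hμτ hlev hcol
  have hA' : IsBadA klo khi (x, μ) := ⟨hμ0, hμτ, hlev, hcol⟩
  have hsecb : sec lo hi klo khi (x, μ) = Dsum lo hi + 1 + (x 0 - lo 0).toNat := by rw [sec, if_pos hA']
  have hx0 : klo 0 ≤ x 0 := by
    rcases hcol with h | h
    · exact (h 0 zero_ne_top).1
    · have := (h 0 zero_ne_top).1; rwa [addE_ne x (Ne.symm hμ0)] at this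
  have hK0 := hK 0
  intro l hl hne
  have hl' := sides_mem_puncturedBonds hp l hl
  rcases mem_plaqLoop_iff.1 ⟨l, hl, rfl⟩ with h | h | h | h <;> rw [h] at hl' hne ⊢
  · -- `(x − e_0, μ)`: first kind one step to the left, or a plain bond
    refine Or.inr ⟨hl', rank_lt_of_sec_lt (subE_ne x zero_ne_top.symm) ?_⟩
    rw [hsecb, sec]
    by_cases hA1 : IsBadA klo khi (x - ev 0, μ)
    · rw [if_pos hA1]; dsimp only; rw [subE_self]; omega
    · rw [if_neg hA1, if_neg (fun h : IsBadB klo khi (x - ev 0, μ) => hμ0 h.1)]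
      have := height_le_Dsum hl'.1; omega
  · -- `(x − e_0 + e_μ, 0)`: a connector, or a plain bond
    by_cases hc : ColK klo khi (x + ev μ)
    · exact Or.inl (conn_mem_niceTree hl' ⟨rfl, by dsimp only; rw [addE_ne _ (Ne.symm hμτ), subE_ne x zero_ne_top.symm, hlev],
        by dsimp only; rw [sub_add_add_ev]; exact hc⟩)
    · have hcx : ColK klo khi x := hcol.resolve_right hc
      have hxμ : x μ = khi μ := coord_eq_khi hμτ hcx hc
      refine Or.inr ⟨hl', rank_lt_of_sec_lt (by dsimp only; rw [addE_ne _ (Ne.symm hμτ), subE_ne x zero_ne_top.symm]) ?_⟩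
      rw [hsecb, sec, if_neg (fun h : IsBadA klo khi (x - ev 0 + ev μ, 0) => h.1 rfl),
        if_neg (fun h : IsBadB klo khi (x - ev 0 + ev μ, 0) => ?_)]
      · have := height_le_Dsum hl'.1; omega
      · have := (h.2.2.1 μ hμτ).2
        dsimp only at this
        rw [addE_self, subE_ne x hμ0] at this
        omega
  · exact absurd (by rw [sub_ev_add_ev]) hne
  · -- `(x − e_0, 0)`: a connector, or a plain bond
    by_cases hcx : ColK klo khi x
    · exact Or.inl (conn_mem_niceTree hl' ⟨rfl, by dsimp only; rw [subE_ne x zero_ne_top.symm, hlev],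
        by dsimp only; rw [sub_ev_add_ev]; exact hcx⟩)
    · have hc : ColK klo khi (x + ev μ) := hcol.resolve_left hcx
      have hxμ : x μ + 1 = klo μ := coord_eq_klo hμτ hc hcx
      refine Or.inr ⟨hl', rank_lt_of_sec_lt (by dsimp only; rw [subE_ne x zero_ne_top.symm]) ?_⟩
      rw [hsecb, sec, if_neg (fun h : IsBadA klo khi (x - ev 0, 0) => h.1 rfl),
        if_neg (fun h : IsBadB klo khi (x - ev 0, 0) => ?_)]
      · have := height_le_Dsum hl'.1; omega
      · have := (h.2.2.1 μ hμτ).1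
        dsimp only at this
        rw [subE_ne x hμ0] at this
        omega

/-- SECOND KIND, the attached plaquette `(x − e_1; 0, 1)` (inside the shadow layer, using a third direction `e_1 ≠ e_0, e_τ`) is
admissible. [cite: Federbush1987PhaseCellIII, §5.3 2)–3) p. 303] -/
theorem plaqB_mem {x : Site (n + 3)} (hb : ((x, (0 : Fin (n + 3))) : Bond (n + 3)) ∈ puncturedBonds lo hi klo khi)
    (hB : IsBadB klo khi (x, 0)) :
    ((x - ev 1, (0 : Fin (n + 3)), (1 : Fin (n + 3))) : LatticeContour.Plaq (n + 3)) ∈ puncturedPlaq lo hi klo khi := by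
  obtain ⟨⟨hx, hx0⟩, -, -⟩ := hb
  obtain ⟨-, hlev, hcol, -⟩ := hB
  dsimp only at hx hx0 hlev hcol
  have hx1 : klo 1 ≤ x 1 := (hcol 1 one_ne_top).1
  have hK1 := hK 1
  have hxm : x - ev 1 ∈ boxSites lo hi := by
    rw [mem_boxSites] at hx ⊢
    intro i
    by_cases hi : i = 1
    · rw [hi, subE_self]; have := hx 1; omega
    · rw [subE_ne x hi]; exact hx i
  have hl1 : (x - ev 1 : Site (n + 3)) (Fin.last (n + 2)) = khi (Fin.last (n + 2)) + 1 := by rw [subE_ne x one_ne_top.symm, hlev]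
  have hl2 : (x - ev 1 + ev 0 : Site (n + 3)) (Fin.last (n + 2)) = khi (Fin.last (n + 2)) + 1 := by rw [addE_ne _ zero_ne_top.symm, hl1]
  have hl4 : (x + ev 0 : Site (n + 3)) (Fin.last (n + 2)) = khi (Fin.last (n + 2)) + 1 := by rw [addE_ne _ zero_ne_top.symm, hlev]
  refine ⟨⟨(zero_ne_one (α := Fin (n + 3))), hxm, by rw [sub_add_add_ev]; exact hx0⟩, ?_, ?_, ?_, ?_⟩ <;> dsimp only
  · exact not_mem_hole_of_gt (by omega)
  · exact not_mem_hole_of_gt (by omega)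
  · rw [sub_ev_add_ev]; exact not_mem_hole_of_gt (by omega)
  · rw [sub_add_add_ev]; exact not_mem_hole_of_gt (by omega)

/-- SECOND KIND, peeling condition: the other three sides of `(x − e_1; 0, 1)` have smaller rank (second kind one step to `−e_1`, a
first-kind bond, or plain bonds). [cite: Federbush1987PhaseCellIII, §5.3 2)–3) p. 303] -/
theorem lowerB {x : Site (n + 3)} (hb : ((x, (0 : Fin (n + 3))) : Bond (n + 3)) ∈ puncturedBonds lo hi klo khi)
    (hB : IsBadB klo khi (x, 0)) :
    ∀ l ∈ plaqLoop (x - ev 1) (0 : Fin (n + 3)) 1, l.1 ≠ (x, 0) →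
      l.1 ∈ niceTree lo hi klo khi ∨ (l.1 ∈ puncturedBonds lo hi klo khi ∧
        niceRank lo hi klo khi l.1 < niceRank lo hi klo khi (x, 0)) := by
  have hp := plaqB_mem hK hb hB
  obtain ⟨-, hlev, hcol, hncol⟩ := hB
  dsimp only at hlev hcol hncol
  have hB' : IsBadB klo khi (x, 0) := ⟨rfl, hlev, hcol, hncol⟩
  have hsecb : sec lo hi klo khi (x, 0) = 2 * Dsum lo hi + 2 + (x 1 - lo 1).toNat := by
    rw [sec, if_neg (fun h : IsBadA klo khi (x, 0) => h.1 rfl), if_pos hB']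
  have hx0 : x 0 = khi 0 := coord_eq_khi zero_ne_top hcol hncol
  have hx1 : klo 1 ≤ x 1 := (hcol 1 one_ne_top).1
  have hK1 := hK 1
  intro l hl hne
  have hl' := sides_mem_puncturedBonds hp l hl
  rcases mem_plaqLoop_iff.1 ⟨l, hl, rfl⟩ with h | h | h | h <;> rw [h] at hl' hne ⊢
  · -- `(x − e_1, 0)`: second kind one step down in `e_1`, or a plain bond
    refine Or.inr ⟨hl', rank_lt_of_sec_lt (subE_ne x one_ne_top.symm) ?_⟩
    rw [hsecb, sec, if_neg (fun h : IsBadA klo khi (x - ev 1, 0) => h.1 rfl)]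
    by_cases hB1 : IsBadB klo khi (x - ev 1, 0)
    · rw [if_pos hB1]; dsimp only; rw [subE_self]; omega
    · rw [if_neg hB1]; have := height_le_Dsum hl'.1; omega
  · -- `(x − e_1 + e_0, 1)`: a plain bond (both endpoints to the right of the shadow)
    refine Or.inr ⟨hl', rank_lt_of_sec_lt (by dsimp only; rw [addE_ne _ zero_ne_top.symm, subE_ne x one_ne_top.symm]) ?_⟩
    rw [hsecb, sec, if_neg (fun h : IsBadA klo khi (x - ev 1 + ev 0, 1) => ?_),
      if_neg (fun h : IsBadB klo khi (x - ev 1 + ev 0, 1) => (zero_ne_one (α := Fin (n + 3))) h.1.symm)]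
    · have := height_le_Dsum hl'.1; omega
    · rcases h.2.2.2 with hc | hc
      · have := (hc 0 zero_ne_top).2
        dsimp only at this
        rw [addE_self, subE_ne x (zero_ne_one (α := Fin (n + 3)))] at this
        omega
      · have := (hc 0 zero_ne_top).2
        dsimp only at this
        rw [addE_ne _ (zero_ne_one (α := Fin (n + 3))), addE_self, subE_ne x (zero_ne_one (α := Fin (n + 3)))] at this
        omega
  · exact absurd (by rw [sub_ev_add_ev]) hne
  · -- `(x − e_1, 1)`: first kind
    have hA1 : IsBadA klo khi (x - ev 1, 1) :=
      ⟨(one_ne_zero (α := Fin (n + 3))), one_ne_top, by dsimp only; rw [subE_ne x one_ne_top.symm, hlev],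
        Or.inr (by dsimp only; rw [sub_ev_add_ev]; exact hcol)⟩
    refine Or.inr ⟨hl', rank_lt_of_sec_lt (subE_ne x one_ne_top.symm) ?_⟩
    rw [hsecb, sec, if_pos hA1]
    dsimp only
    rw [subE_ne x (zero_ne_one (α := Fin (n + 3)))]
    have := toNat_le_Dsum hl'.1.1 0
    dsimp only at this
    rw [subE_ne x (zero_ne_one (α := Fin (n + 3)))] at this
    omega

/-- PLAIN non-tree bonds (neither kind, not a gauge bond): the comb's attached plaquette `(x − e_ν; μ, ν)` (`ν` the top direction) stays in
the punctured block — it could only dip into the hole from the first shadow layer, which is where the two special kinds live.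
[cite: Federbush1987PhaseCellIII, §5.3 2)–3) p. 303] -/
theorem plaqC_mem {x : Site (n + 3)} {μ : Fin (n + 3)} (hb : ((x, μ) : Bond (n + 3)) ∈ puncturedBonds lo hi klo khi)
    (hT : ((x, μ) : Bond (n + 3)) ∉ niceTree lo hi klo khi) (hA : ¬ IsBadA klo khi (x, μ)) (hB : ¬ IsBadB klo khi (x, μ)) :
    ∃ ν : Fin (n + 3), combPlaq lo (x, μ) = (x - ev ν, μ, ν) ∧ μ < ν ∧ lo ν < x ν ∧ (∀ ρ : Fin (n + 3), ν < ρ → x ρ = lo ρ) ∧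
      ((x - ev ν, μ, ν) : LatticeContour.Plaq (n + 3)) ∈ puncturedPlaq lo hi klo khi := by
  obtain ⟨hbox, hxK, hxμK⟩ := hb
  dsimp only at hxK hxμK
  have hcomb : ((x, μ) : Bond (n + 3)) ∉ combTree lo hi := fun hc => hT ⟨⟨hbox, hxK, hxμK⟩, Or.inl hc⟩
  have h0 : height lo ((x, μ) : Bond (n + 3)) ≠ 0 := fun h0 => hcomb (mem_combTree_of_height_eq_zero hbox h0)
  obtain ⟨ν, hp, hμν, hne, htop⟩ := combPlaq_spec h0
  have hν : lo ν < x ν := lt_of_le_of_ne (mem_boxSites.1 (fst_mem_boxSites hbox) ν).1 (Ne.symm hne)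
  have hμτ : μ ≠ (Fin.last (n + 2)) := Fin.ne_last_of_lt hμν
  refine ⟨ν, hp, hμν, hν, htop, attached_mem_boxPlaq hbox hμν hν, ?_, ?_, by rw [sub_ev_add_ev]; exact hxK,
    by rw [sub_add_add_ev]; exact hxμK⟩
  · -- the corner `x − e_ν`
    dsimp only
    by_cases hντ : ν = (Fin.last (n + 2))
    · subst hντ
      intro hmem
      obtain ⟨hcol, h1, h2⟩ := mem_hole_iff.1 hmem
      rw [subE_self] at h1 h2
      have hcx : ColK klo khi x := (colK_congr fun i hi => subE_ne x hi).1 hcol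
      have hxτ : x (Fin.last (n + 2)) = khi (Fin.last (n + 2)) + 1 := by
        have hx' : ¬ (klo (Fin.last (n + 2)) ≤ x (Fin.last (n + 2)) ∧ x (Fin.last (n + 2)) ≤ khi (Fin.last (n + 2))) := fun h => hxK (mem_hole_iff.2 ⟨hcx, h⟩)
        omega
      by_cases hμ0 : μ = 0
      · subst hμ0
        by_cases hc : ColK klo khi (x + ev 0)
        · exact hT ⟨⟨hbox, hxK, hxμK⟩, Or.inr ⟨rfl, hxτ, hc⟩⟩
        · exact hB ⟨rfl, hxτ, hcx, hc⟩
      · exact hA ⟨hμ0, hμτ, hxτ, Or.inl hcx⟩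
    · have : (x - ev ν : Site (n + 3)) (Fin.last (n + 2)) = lo (Fin.last (n + 2)) := by rw [subE_ne x (Ne.symm hντ), htop _ (lt_top_of_ne hντ)]
      exact not_mem_hole_of_lt (by have := (hK (Fin.last (n + 2))).1; omega)
  · -- the corner `x − e_ν + e_μ`
    dsimp only
    by_cases hντ : ν = (Fin.last (n + 2))
    · subst hντ
      intro hmem
      obtain ⟨hcol, h1, h2⟩ := mem_hole_iff.1 hmem
      rw [addE_ne _ hμτ.symm, subE_self] at h1 h2
      have hcx : ColK klo khi (x + ev μ) :=
        (colK_congr (x := x + ev μ) fun i hi => by rw [add_ev_apply, add_ev_apply, subE_ne x hi]).1 hcol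
      have hxτ : x (Fin.last (n + 2)) = khi (Fin.last (n + 2)) + 1 := by
        have hx' : ¬ (klo (Fin.last (n + 2)) ≤ (x + ev μ) (Fin.last (n + 2)) ∧ (x + ev μ) (Fin.last (n + 2)) ≤ khi (Fin.last (n + 2))) := fun h => hxμK (mem_hole_iff.2 ⟨hcx, h⟩)
        rw [addE_ne _ hμτ.symm] at hx'
        omega
      by_cases hμ0 : μ = 0
      · subst hμ0
        exact hT ⟨⟨hbox, hxK, hxμK⟩, Or.inr ⟨rfl, hxτ, hcx⟩⟩
      · exact hA ⟨hμ0, hμτ, hxτ, Or.inr hcx⟩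
    · have : (x - ev ν + ev μ : Site (n + 3)) (Fin.last (n + 2)) = lo (Fin.last (n + 2)) := by
        rw [addE_ne _ hμτ.symm, subE_ne x (Ne.symm hντ), htop _ (lt_top_of_ne hντ)]
      exact not_mem_hole_of_lt (by have := (hK (Fin.last (n + 2))).1; omega)

/-- PLAIN non-tree bonds, peeling condition: the two `e_ν`-sides of the comb plaquette are comb bonds of the punctured block (gauge
bonds) and the fourth side is a comb bond or has smaller rank (one level lower, or the same level and height one less).
[cite: Federbush1987PhaseCellIII, §5.3 2)–3) p. 303] -/
theorem lowerC {x : Site (n + 3)} {μ : Fin (n + 3)} (hb : ((x, μ) : Bond (n + 3)) ∈ puncturedBonds lo hi klo khi)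
    (hT : ((x, μ) : Bond (n + 3)) ∉ niceTree lo hi klo khi) (hA : ¬ IsBadA klo khi (x, μ)) (hB : ¬ IsBadB klo khi (x, μ)) :
    ∀ l ∈ plaqLoop (combPlaq lo (x, μ)).1 (combPlaq lo (x, μ)).2.1 (combPlaq lo (x, μ)).2.2, l.1 ≠ (x, μ) →
      l.1 ∈ niceTree lo hi klo khi ∨ (l.1 ∈ puncturedBonds lo hi klo khi ∧
        niceRank lo hi klo khi l.1 < niceRank lo hi klo khi (x, μ)) := by
  obtain ⟨ν, hp, hμν, hν, htop, hmem⟩ := plaqC_mem hK hb hT hA hB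
  have hbox := hb.1
  have hμτ : μ ≠ (Fin.last (n + 2)) := Fin.ne_last_of_lt hμν
  rw [hp]
  dsimp only
  intro l hl hne
  have hl' := sides_mem_puncturedBonds hmem l hl
  rcases mem_plaqLoop_iff.1 ⟨l, hl, rfl⟩ with h | h | h | h <;> rw [h] at hl' hne ⊢
  · -- `(x − e_ν, μ)`: comb bond, or lower
    by_cases hc : ((x - ev ν, μ) : Bond (n + 3)) ∈ combTree lo hi
    · exact Or.inl (comb_mem_niceTree hl' hc)
    · refine Or.inr ⟨hl', ?_⟩
      by_cases hντ : ν = (Fin.last (n + 2))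
      · subst hντ
        exact rank_lt_of_level hl'.1 (by dsimp only; rw [subE_self]; omega) (by dsimp only; rw [subE_self]; omega)
      · have hlev : (x - ev ν) (Fin.last (n + 2)) = x (Fin.last (n + 2)) := subE_ne x (Ne.symm hντ)
        have hxτ : x (Fin.last (n + 2)) = lo (Fin.last (n + 2)) := htop _ (lt_top_of_ne hντ)
        have hKτ := hK (Fin.last (n + 2))
        refine rank_lt_of_sec_lt hlev ?_
        have hnA : ¬ IsBadA klo khi (x - ev ν, μ) := fun h => by have := h.2.2.1; dsimp only at this; omega
        have hnB : ¬ IsBadB klo khi (x - ev ν, μ) := fun h => by have := h.2.1; dsimp only at this; omega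
        rw [sec, if_neg hnA, if_neg hnB, sec, if_neg hA, if_neg hB]
        have := height_lower lo hμν hν (x := x)
        omega
  · exact Or.inl (comb_mem_niceTree hl' (lowerShiftSide_mem_combTree hbox hμν hν htop))
  · exact absurd (by rw [sub_ev_add_ev]) hne
  · exact Or.inl (comb_mem_niceTree hl' (lowerSide_mem_combTree hbox hν htop))

end Cases

/-! ## §6 The peeling of the punctured block and the Observation for every group -/

section Peeling

variable {lo hi klo khi : Site (n + 3)}

/-- The attached plaquette: first kind ↦ `(x − e_0; μ, 0)`, second kind ↦ `(x − e_1; 0, 1)`, otherwise the comb's `(x − e_ν; μ, ν)`.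
[cite: Federbush1987PhaseCellIII, §5.3 2)–3) p. 303] -/
noncomputable def nicePlaq (lo klo khi : Site (n + 3)) (b : Bond (n + 3)) : LatticeContour.Plaq (n + 3) :=
  if IsBadA klo khi b then (b.1 - ev 0, b.2, 0) else if IsBadB klo khi b then (b.1 - ev 1, 0, 1) else combPlaq lo b

/-- **THE PUNCTURED BLOCK IS PEELABLE in the extended axial gauge** (dimension `n + 3 ≥ 3`, hole in the interior): every bond of
`[lo, hi] ∖ K` off the gauge bonds is the last unknown side of an admissible plaquette, in the order `niceRank`.
[cite: Federbush1987PhaseCellIII, §5.3 2)–3) p. 303] -/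
noncomputable def nicePeeling (hK : ∀ i, lo i < klo i ∧ klo i ≤ khi i ∧ khi i < hi i) :
    Peeling (puncturedPlaq lo hi klo khi) (puncturedBonds lo hi klo khi) (niceTree lo hi klo khi) where
  rank := niceRank lo hi klo khi
  plaq := nicePlaq lo klo khi
  plaq_mem := by
    rintro ⟨x, μ⟩ hb hT
    by_cases hA : IsBadA klo khi (x, μ)
    · rw [nicePlaq, if_pos hA]; exact plaqA_mem hK hb hA
    · by_cases hB : IsBadB klo khi (x, μ)
      · rw [nicePlaq, if_neg hA, if_pos hB]
        have hμ : μ = 0 := hB.1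
        subst hμ
        exact plaqB_mem hK hb hB
      · rw [nicePlaq, if_neg hA, if_neg hB]
        obtain ⟨ν, hp, -, -, -, hmem⟩ := plaqC_mem hK hb hT hA hB
        rw [hp]; exact hmem
  plaq_ne := by
    rintro ⟨x, μ⟩ hb hT
    by_cases hA : IsBadA klo khi (x, μ)
    · rw [nicePlaq, if_pos hA]; exact hA.1
    · by_cases hB : IsBadB klo khi (x, μ)
      · rw [nicePlaq, if_neg hA, if_pos hB]; exact (zero_ne_one (α := Fin (n + 3)))
      · rw [nicePlaq, if_neg hA, if_neg hB]
        obtain ⟨ν, hp, hμν, -⟩ := plaqC_mem hK hb hT hA hB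
        rw [hp]; exact ne_of_lt hμν
  mem_plaq := by
    rintro ⟨x, μ⟩ hb hT
    by_cases hA : IsBadA klo khi (x, μ)
    · rw [nicePlaq, if_pos hA]
      exact mem_plaqLoop_iff.2 (Or.inr (Or.inr (Or.inl (by dsimp only; rw [sub_ev_add_ev]))))
    · by_cases hB : IsBadB klo khi (x, μ)
      · rw [nicePlaq, if_neg hA, if_pos hB]
        have hμ : μ = 0 := hB.1
        subst hμ
        exact mem_plaqLoop_iff.2 (Or.inr (Or.inr (Or.inl (by dsimp only; rw [sub_ev_add_ev]))))
      · rw [nicePlaq, if_neg hA, if_neg hB]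
        obtain ⟨ν, hp, -⟩ := plaqC_mem hK hb hT hA hB
        rw [hp]
        exact mem_plaqLoop_iff.2 (Or.inr (Or.inr (Or.inl (by rw [sub_ev_add_ev]))))
  lower := by
    rintro ⟨x, μ⟩ hb hT
    by_cases hA : IsBadA klo khi (x, μ)
    · rw [nicePlaq, if_pos hA]; exact lowerA hK hb hA
    · by_cases hB : IsBadB klo khi (x, μ)
      · rw [nicePlaq, if_neg hA, if_pos hB]
        have hμ : μ = 0 := hB.1
        subst hμ
        exact lowerB hK hb hB
      · rw [nicePlaq, if_neg hA, if_neg hB]; exact lowerC hK hb hT hA hB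

variable {G : Type*} [Group G]

/-- **The Observation p. 303 on the nice block, EVERY group.**  On the punctured block `[lo, hi] ∖ [klo, khi]` of `ℤ^{n+3}` (hole in the
interior), two `G`-configurations equal to `ε` on the extended axial gauge (comb bonds of the punctured block + connectors) with the same
plaquette variable on every plaquette of the punctured block agree on every bond of the punctured block — abelian or not, with no appeal
to simple connectivity (which p32's `simplyConnected_boxMinusBox` provides separately). [cite: Federbush1987PhaseCellIII, §5.3 2)–3) Observation p. 303] -/
theorem eq_of_plaq_eq_of_niceGauge (hK : ∀ i, lo i < klo i ∧ klo i ≤ khi i ∧ khi i < hi i) (u u' : Bond (n + 3) → G)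
    (hg : ∀ b ∈ niceTree lo hi klo khi, u b = 1) (hg' : ∀ b ∈ niceTree lo hi klo khi, u' b = 1)
    (hplaq : ∀ p ∈ puncturedPlaq lo hi klo khi,
      wordHol u (plaqLoop p.1 p.2.1 p.2.2) = wordHol u' (plaqLoop p.1 p.2.1 p.2.2)) :
    ∀ b ∈ puncturedBonds lo hi klo khi, u b = u' b :=
  (nicePeeling hK).eq_of_plaq_eq u u' hg hg' hplaq

/-- Flat form on the nice block: plaquette variables `≡ ε` on the punctured block and `ε` on the extended gauge ⇒ `ε` throughout.
[cite: Federbush1987PhaseCellIII, §5.3 2)–3) Observation p. 303] -/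
theorem eq_one_of_flat_of_niceGauge (hK : ∀ i, lo i < klo i ∧ klo i ≤ khi i ∧ khi i < hi i) (u : Bond (n + 3) → G)
    (hg : ∀ b ∈ niceTree lo hi klo khi, u b = 1)
    (hflat : ∀ p ∈ puncturedPlaq lo hi klo khi, wordHol u (plaqLoop p.1 p.2.1 p.2.2) = 1) :
    ∀ b ∈ puncturedBonds lo hi klo khi, u b = 1 :=
  (nicePeeling hK).eq_one_of_flat u hg hflat

/-- On the nice block every bond variable lies in the subgroup generated by the plaquette variables (extended axial gauge).
[cite: Federbush1987PhaseCellIII, §5.3 2)–3) Observation p. 303] -/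
theorem mem_closure_plaq_of_niceGauge (hK : ∀ i, lo i < klo i ∧ klo i ≤ khi i ∧ khi i < hi i) (u : Bond (n + 3) → G)
    (hg : ∀ b ∈ niceTree lo hi klo khi, u b = 1) :
    ∀ b ∈ puncturedBonds lo hi klo khi, u b ∈ Subgroup.closure
      ((fun p : LatticeContour.Plaq (n + 3) => wordHol u (plaqLoop p.1 p.2.1 p.2.2)) '' puncturedPlaq lo hi klo khi) :=
  (nicePeeling hK).mem_closure_plaq u hg

end Peeling

/-! ## §7 It IS a gauge: every configuration can be brought to `ε` on the extended axial gauge bonds -/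

section Gauge

variable {lo hi klo khi : Site (n + 3)} {G : Type*} [Group G]

/-- The initial point of the connector chain through the column of `y`: its `e_0`-coordinate `klo_0 − 1` (just outside the shadow),
its level the first shadow layer `khi_τ + 1`, its other coordinates those of `y`. [cite: Federbush1987PhaseCellIII, §5.3 3) p. 303] -/
def connBase (klo khi y : Site (n + 3)) : Site (n + 3) := fun i =>
  if i = 0 then klo 0 - 1 else if i = (Fin.last (n + 2)) then khi (Fin.last (n + 2)) + 1 else y i

/-- The number of connectors from the initial point to the column of `y`. [cite: Federbush1987PhaseCellIII, §5.3 3) p. 303] -/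
def connLen (klo y : Site (n + 3)) : ℕ := (y 0 - klo 0 + 1).toNat

/-- THE SHADOW GAUGE FUNCTION: on the shadow of the hole (columns over `K`, levels above `K`) the contour variable of the connector
chain of the column, `ε` elsewhere. [cite: Federbush1987PhaseCellIII, §5.3 3)–4) p. 303] -/
def shadowFn (klo khi : Site (n + 3)) (u : Bond (n + 3) → G) (y : Site (n + 3)) : G :=
  if ColK klo khi y ∧ khi (Fin.last (n + 2)) < y (Fin.last (n + 2)) then wordHol u (seg (connBase klo khi y) 0 (connLen klo y)) else 1

/-- The connector chain depends only on the column. [cite: Federbush1987PhaseCellIII, §5.3 3) p. 303] -/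
theorem connBase_congr {y y' : Site (n + 3)} (h : ∀ i, i ≠ 0 → i ≠ (Fin.last (n + 2)) → y' i = y i) :
    connBase klo khi y' = connBase klo khi y := by
  funext i
  unfold connBase
  by_cases h0 : i = 0
  · rw [if_pos h0, if_pos h0]
  · rw [if_neg h0, if_neg h0]
    by_cases hτ : i = (Fin.last (n + 2))
    · rw [if_pos hτ, if_pos hτ]
    · rw [if_neg hτ, if_neg hτ, h i h0 hτ]

/-- The end of the connector chain of the column of `w + e_0` in the first shadow layer is `w`. [cite: Federbush1987PhaseCellIII, §5.3 3) p. 303] -/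
theorem connBase_add_len {w : Site (n + 3)} (hw : w (Fin.last (n + 2)) = khi (Fin.last (n + 2)) + 1) (hw0 : klo 0 ≤ w 0 + 1) :
    connBase klo khi w + ((connLen klo w : ℕ) : ℤ) • ev 0 = w := by
  have hL : ((connLen klo w : ℕ) : ℤ) = w 0 - klo 0 + 1 := by unfold connLen; exact Int.toNat_of_nonneg (by omega)
  funext i
  rw [add_smul_ev_apply, hL]
  unfold connBase
  by_cases h0 : i = 0
  · rw [if_pos h0, if_pos h0, h0]; ring
  · rw [if_neg h0, if_neg h0, add_zero]
    by_cases hτ : i = (Fin.last (n + 2))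
    · rw [if_pos hτ, hτ, hw]
    · rw [if_neg hτ]

/-- **The shadow gauge function fixes the connectors**: `h(w + e_0) = h(w) · u⟨w, w + e_0⟩` across every connector.
[cite: Federbush1987PhaseCellIII, §5.3 3) p. 303] -/
theorem shadowFn_conn (u : Bond (n + 3) → G) {w : Site (n + 3)} (hc : IsConn klo khi (w, 0)) :
    shadowFn klo khi u (w + ev 0) = shadowFn klo khi u w * u (w, 0) := by
  obtain ⟨-, hlev, hcol⟩ := hc
  dsimp only at hlev hcol
  have hw0 : klo 0 ≤ w 0 + 1 := by have := (hcol 0 zero_ne_top).1; rwa [addE_self] at this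
  have hlev' : (w + ev 0 : Site (n + 3)) (Fin.last (n + 2)) = khi (Fin.last (n + 2)) + 1 := by rw [addE_ne _ zero_ne_top.symm, hlev]
  have hlen : connLen klo (w + ev 0) = connLen klo w + 1 := by
    unfold connLen; rw [addE_self]; omega
  have hbase : connBase klo khi (w + ev 0) = connBase klo khi w := connBase_congr fun i hi _ => addE_ne w hi
  rw [shadowFn, if_pos ⟨hcol, by omega⟩, hlen, hbase, seg_succ, wordHol_append, wordHol_singleton, connBase_add_len hlev hw0]
  dsimp only
  rw [if_pos rfl, shadowFn]
  by_cases hcw : ColK klo khi w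
  · rw [if_pos ⟨hcw, by omega⟩]
  · have h0 : w 0 + 1 = klo 0 := coord_eq_klo zero_ne_top hcol hcw
    have hL : connLen klo w = 0 := by unfold connLen; omega
    rw [if_neg (fun h => hcw h.1), hL, seg_zero, wordHol_nil']

/-- The shadow gauge function is `ε` at and below the top level of the hole. [cite: Federbush1987PhaseCellIII, §5.3 3) p. 303] -/
theorem shadowFn_of_le (u : Bond (n + 3) → G) {y : Site (n + 3)} (hy : y (Fin.last (n + 2)) ≤ khi (Fin.last (n + 2))) : shadowFn klo khi u y = 1 := by
  rw [shadowFn, if_neg (fun h => by have := h.2; omega)]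

/-- The shadow gauge function is constant along the columns above the hole. [cite: Federbush1987PhaseCellIII, §5.3 3) p. 303] -/
theorem shadowFn_add_ev_top (u : Bond (n + 3) → G) {y : Site (n + 3)} (hy : khi (Fin.last (n + 2)) < y (Fin.last (n + 2))) :
    shadowFn klo khi u (y + ev (Fin.last (n + 2))) = shadowFn klo khi u y := by
  have hcol : ColK klo khi (y + ev (Fin.last (n + 2))) ↔ ColK klo khi y := colK_congr fun i hi => addE_ne y hi
  have hbase : connBase klo khi (y + ev (Fin.last (n + 2))) = connBase klo khi y := connBase_congr fun i _ hi => addE_ne y hi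
  have hlen : connLen klo (y + ev (Fin.last (n + 2))) = connLen klo y := by unfold connLen; rw [addE_ne y zero_ne_top]
  unfold shadowFn
  rw [hbase, hlen, addE_self]
  by_cases hc : ColK klo khi y
  · rw [if_pos ⟨hcol.2 hc, by omega⟩, if_pos ⟨hc, hy⟩]
  · rw [if_neg (fun h => hc (hcol.1 h.1)), if_neg (fun h => hc h.1)]

/-- THE GAUGE FUNCTION OF THE NICE BLOCK: first the comb gauge function of the box, then the shadow gauge function of the resulting
configuration. [cite: Federbush1987PhaseCellIII, §5.3 3)–4) p. 303] -/
def niceFn (lo klo khi : Site (n + 3)) (u : Bond (n + 3) → G) (y : Site (n + 3)) : G :=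
  shadowFn klo khi (gaugeAct (combFn lo u) u) y * combFn lo u y

/-- **The extended axial gauge IS a gauge** («to define an axial gauge in each nice block»): for every configuration `u` of any group,
the gauge function `niceFn` is based (`= ε` at the corner) and carries `u` to a configuration equal to `ε` on every comb bond of the
punctured block and on every connector — so no product of gauge-bond variables around a closed contour is constrained (the gauge bonds
contain no cycle). [cite: Federbush1987PhaseCellIII, §5.3 3)–4) p. 303] -/
theorem gaugeAct_niceFn_eq_one (hK : ∀ i, lo i < klo i ∧ klo i ≤ khi i ∧ khi i < hi i) (u : Bond (n + 3) → G) :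
    ∀ b ∈ niceTree lo hi klo khi, gaugeAct (niceFn lo klo khi u) u b = 1 := by
  have hmul : gaugeAct (niceFn lo klo khi u) u = gaugeAct (shadowFn klo khi (gaugeAct (combFn lo u) u)) (gaugeAct (combFn lo u) u) :=
    gaugeAct_mul _ _ u
  rw [hmul]
  set u₁ := gaugeAct (combFn lo u) u with hu₁
  have hKτ := hK (Fin.last (n + 2))
  rintro ⟨x, μ⟩ ⟨⟨hbox, hxK, hxμK⟩, hc | hc⟩
  · -- comb bonds of the punctured block: `u₁ = ε` there, and the shadow function agrees at the two endpoints
    have h1 : u₁ (x, μ) = 1 := gaugeAct_combFn_eq_one u _ hc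
    rw [gaugeAct_apply, h1, mul_one]
    dsimp only
    obtain ⟨-, htop⟩ := mem_combTree.1 hc
    dsimp only at htop hxK hxμK
    by_cases hμτ : μ = (Fin.last (n + 2))
    · subst hμτ
      by_cases hlev : khi (Fin.last (n + 2)) < x (Fin.last (n + 2))
      · rw [shadowFn_add_ev_top _ hlev, mul_inv_cancel]
      · have hcol : ColK klo khi (x + ev (Fin.last (n + 2))) ↔ ColK klo khi x := colK_congr fun i hi => addE_ne x hi
        rw [shadowFn_of_le _ (not_lt.1 hlev), one_mul, inv_eq_one]
        by_cases hle : (x + ev (Fin.last (n + 2)) : Site (n + 3)) (Fin.last (n + 2)) ≤ khi (Fin.last (n + 2))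
        · exact shadowFn_of_le _ hle
        · rw [addE_self] at hle
          by_cases hcx : ColK klo khi x
          · exact absurd (mem_hole_iff.2 ⟨hcx, by omega, by omega⟩) hxK
          · rw [shadowFn, if_neg (fun h => hcx (hcol.1 h.1))]
    · have hxτ : x (Fin.last (n + 2)) = lo (Fin.last (n + 2)) := htop (Fin.last (n + 2)) (lt_top_of_ne hμτ)
      have h2 : (x + ev μ : Site (n + 3)) (Fin.last (n + 2)) = lo (Fin.last (n + 2)) := by rw [addE_ne x (Ne.symm hμτ), hxτ]
      rw [shadowFn_of_le _ (by omega), shadowFn_of_le _ (by omega), one_mul, inv_one]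
  · -- connectors
    obtain ⟨hμ, -, -⟩ := id hc
    dsimp only at hμ
    subst hμ
    rw [gaugeAct_apply]
    dsimp only
    rw [shadowFn_conn u₁ hc]
    group

/-- The gauge function is based: `= ε` at the corner `lo`. [cite: Federbush1987PhaseCellIII, §5.3 3) p. 303] -/
theorem niceFn_corner (hK : ∀ i, lo i < klo i ∧ klo i ≤ khi i ∧ khi i < hi i) (u : Bond (n + 3) → G) :
    niceFn lo klo khi u lo = 1 := by
  have := hK (Fin.last (n + 2))
  rw [niceFn, combFn_corner, mul_one, shadowFn_of_le _ (by omega)]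

/-- **Existence of the nice-block axial gauge**: every configuration is carried by a based gauge transformation to one equal to `ε` on
the extended axial gauge bonds; plaquette variables transform by conjugation at the base corner.
[cite: Federbush1987PhaseCellIII, §5.3 3)–4) p. 303] -/
theorem exists_niceGauge (hK : ∀ i, lo i < klo i ∧ klo i ≤ khi i ∧ khi i < hi i) (u : Bond (n + 3) → G) :
    ∃ h : Site (n + 3) → G, h lo = 1 ∧ (∀ b ∈ niceTree lo hi klo khi, gaugeAct h u b = 1) ∧
      ∀ (z : Site (n + 3)) (μ ν : Fin (n + 3)),
        wordHol (gaugeAct h u) (plaqLoop z μ ν) = h z * wordHol u (plaqLoop z μ ν) * (h z)⁻¹ :=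
  ⟨niceFn lo klo khi u, niceFn_corner hK u, gaugeAct_niceFn_eq_one hK u, wordHol_gaugeAct_plaqLoop _ u⟩

/-- **The Observation on the nice block, orbit form**: two ARBITRARY configurations of the punctured block whose plaquette variables agree
after the based gauge fixing agree on every bond of the punctured block after it. [cite: Federbush1987PhaseCellIII, §5.3 2)–4) p. 303] -/
theorem observation_niceGauge_orbit (hK : ∀ i, lo i < klo i ∧ klo i ≤ khi i ∧ khi i < hi i) (u u' : Bond (n + 3) → G)
    (hplaq : ∀ p ∈ puncturedPlaq lo hi klo khi,
      wordHol (gaugeAct (niceFn lo klo khi u) u) (plaqLoop p.1 p.2.1 p.2.2) =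
        wordHol (gaugeAct (niceFn lo klo khi u') u') (plaqLoop p.1 p.2.1 p.2.2)) :
    ∀ b ∈ puncturedBonds lo hi klo khi, gaugeAct (niceFn lo klo khi u) u b = gaugeAct (niceFn lo klo khi u') u' b :=
  eq_of_plaq_eq_of_niceGauge hK _ _ (gaugeAct_niceFn_eq_one hK u) (gaugeAct_niceFn_eq_one hK u') hplaq

end Gauge

/-! ## §8 Packaged for `d ≥ 3` -/

section AnyDim

/-- **Step 3) and the Observation on the punctured block, every `d ≧ 3`, every group**: there is a set `T` of gauge bonds of the punctured
block `[lo, hi] ∖ [klo, khi] ⊂ ℤ^d` containing its comb bonds («will also be assigned ε») such that (i) the punctured block is peelable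
relative to `T` — so `T`-gauged configurations with equal plaquette variables on the punctured block coincide there
(`PeelingObservation.Peeling.eq_of_plaq_eq`) — and (ii) every configuration of every group can be gauged, by a based gauge transformation,
to `ε` on `T` («to define an axial gauge in each nice block»). [cite: Federbush1987PhaseCellIII, §5.3 2)–3) Observation p. 303] -/
theorem observation_puncturedBlock {d : ℕ} (hd : 3 ≤ d) {lo hi klo khi : Site d}
    (hK : ∀ i, lo i < klo i ∧ klo i ≤ khi i ∧ khi i < hi i) :
    ∃ T : Set (Bond d), T ⊆ puncturedBonds lo hi klo khi ∧
      (∀ b ∈ puncturedBonds lo hi klo khi, b ∈ combTree lo hi → b ∈ T) ∧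
      Nonempty (Peeling (puncturedPlaq lo hi klo khi) (puncturedBonds lo hi klo khi) T) ∧
      ∀ (G : Type*) [Group G] (u : Bond d → G), ∃ h : Site d → G, h lo = 1 ∧ ∀ b ∈ T, gaugeAct h u b = 1 := by
  obtain ⟨n, rfl⟩ := Nat.exists_eq_add_of_le' hd
  refine ⟨niceTree lo hi klo khi, niceTree_subset, fun b hb hc => comb_mem_niceTree hb hc, ⟨nicePeeling hK⟩, fun G _ u => ?_⟩
  obtain ⟨h, h1, h2, -⟩ := exists_niceGauge (lo := lo) (hi := hi) hK u
  exact ⟨h, h1, h2⟩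

end AnyDim

/-! ## §9 (v1.1) The extended axial gauge is a MAXIMAL tree of the punctured block: it spans, and the gauge fixing is complete -/

section Spanning

variable {lo hi klo khi : Site (n + 3)}

/-- **The comb contour of a site off the shadow stays in the punctured block**: if the column of `B` misses the hole, or `B` lies below
the hole, every bond of `Γ_{lo,B}` is a bond of the punctured block. [cite: Federbush1987PhaseCellIII, §5.3 3) p. 303] -/
theorem combPath_mem_punctured (hK : ∀ i, lo i < klo i ∧ klo i ≤ khi i ∧ khi i < hi i) {B : Site (n + 3)}
    (hB : B ∈ boxSites lo hi) (hoff : ¬ ColK klo khi B ∨ B (Fin.last (n + 2)) < klo (Fin.last (n + 2))) :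
    ∀ l ∈ combPath lo B (n + 3), l.1 ∈ puncturedBonds lo hi klo khi := by
  intro l hl
  have hcomb := combPath_subset_combTree hB (n + 3) l hl
  obtain ⟨j, hj, t, -, ht, rfl⟩ := mem_combPath hl
  refine ⟨combTree_subset lo hi hcomb, ?_, ?_⟩ <;> dsimp only
  · -- the initial point of the letter
    by_cases hjτ : j = n + 2
    · -- vertical letter: same column as `B`
      have hcol : ColK klo khi (truncSite j lo B + (t : ℤ) • ev ⟨j, hj⟩) ↔ ColK klo khi B :=
        colK_congr fun i hi => by
          rw [truncSite_add_smul_apply hj]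
          have : (i : ℕ) < j := by
            have h1 := Fin.lt_last_iff_ne_last.2 hi
            have h2 : (i : ℕ) < n + 2 := h1
            omega
          rw [if_pos this]
      rcases hoff with h | h
      · exact fun hmem => h (hcol.1 (mem_hole_iff.1 hmem).1)
      · refine not_mem_hole_of_lt ?_
        rw [truncSite_add_smul_apply hj]
        have hτj : ((Fin.last (n + 2) : Fin (n + 3)) : ℕ) = j := by rw [Fin.val_last]; omega
        rw [if_neg (by omega), if_pos hτj]
        have hjτ' : (⟨j, hj⟩ : Fin (n + 3)) = Fin.last (n + 2) := Fin.ext (by simp; omega)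
        rw [hjτ'] at ht
        have := mem_boxSites.1 hB (Fin.last (n + 2))
        omega
    · refine not_mem_hole_of_lt ?_
      rw [truncSite_add_smul_apply hj]
      have h1 : ¬ ((Fin.last (n + 2) : Fin (n + 3)) : ℕ) < j := by rw [Fin.val_last]; omega
      have h2 : ¬ ((Fin.last (n + 2) : Fin (n + 3)) : ℕ) = j := by rw [Fin.val_last]; omega
      rw [if_neg h1, if_neg h2]
      exact (hK _).1
  · -- the final point of the letter
    by_cases hjτ : j = n + 2
    · have hjτ' : (⟨j, hj⟩ : Fin (n + 3)) = Fin.last (n + 2) := Fin.ext (by simp; omega)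
      have hcol : ColK klo khi (truncSite j lo B + (t : ℤ) • ev ⟨j, hj⟩ + ev ⟨j, hj⟩) ↔ ColK klo khi B :=
        colK_congr fun i hi => by
          have hne : i ≠ ⟨j, hj⟩ := by rw [hjτ']; exact hi
          have hlt : (i : ℕ) < j := by
            have h1 := Fin.lt_last_iff_ne_last.2 hi
            have h2 : (i : ℕ) < n + 2 := h1
            omega
          rw [add_ev_apply, if_neg hne, add_zero, truncSite_add_smul_apply hj, if_pos hlt]
      rcases hoff with h | h
      · exact fun hmem => h (hcol.1 (mem_hole_iff.1 hmem).1)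
      · refine not_mem_hole_of_lt ?_
        rw [add_ev_apply, truncSite_add_smul_apply hj, hjτ', if_pos rfl]
        have hτj : ((Fin.last (n + 2) : Fin (n + 3)) : ℕ) = j := by rw [Fin.val_last]; omega
        rw [if_neg (by omega), if_pos hτj]
        rw [hjτ'] at ht
        have := mem_boxSites.1 hB (Fin.last (n + 2))
        omega
    · refine not_mem_hole_of_lt ?_
      have hne : (Fin.last (n + 2) : Fin (n + 3)) ≠ ⟨j, hj⟩ := fun h => hjτ (by have := congrArg Fin.val h; simp at this; omega)
      rw [add_ev_apply, if_neg hne, add_zero, truncSite_add_smul_apply hj]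
      have h1 : ¬ ((Fin.last (n + 2) : Fin (n + 3)) : ℕ) < j := by rw [Fin.val_last]; omega
      have h2 : ¬ ((Fin.last (n + 2) : Fin (n + 3)) : ℕ) = j := by rw [Fin.val_last]; omega
      rw [if_neg h1, if_neg h2]
      exact (hK _).1

/-- The top of the connector chain of the column of `y`: the site of the first shadow layer under (or at) `y`.
[cite: Federbush1987PhaseCellIII, §5.3 3) p. 303] -/
theorem connBase_add_connLen {y : Site (n + 3)} (hy0 : klo 0 ≤ y 0 + 1) :
    connBase klo khi y + ((connLen klo y : ℕ) : ℤ) • ev 0 =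
      fun i => if i = Fin.last (n + 2) then khi (Fin.last (n + 2)) + 1 else y i := by
  have hL : ((connLen klo y : ℕ) : ℤ) = y 0 - klo 0 + 1 := by unfold connLen; exact Int.toNat_of_nonneg (by omega)
  funext i
  rw [add_smul_ev_apply, hL]
  unfold connBase
  by_cases h0 : i = 0
  · rw [if_pos h0, if_pos h0, h0, if_neg zero_ne_top]; ring
  · rw [if_neg h0, if_neg h0, add_zero]

/-- THE GAUGE CONTOUR of a site of the punctured block: for a site of the shadow, the comb contour to the initial point of its connector
chain, the chain, then straight up its column; otherwise its comb contour. [cite: Federbush1987PhaseCellIII, §5.3 3) p. 303] -/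
def nicePath (lo klo khi y : Site (n + 3)) : List (Letter (n + 3)) :=
  if ColK klo khi y ∧ khi (Fin.last (n + 2)) < y (Fin.last (n + 2)) then
    combPath lo (connBase klo khi y) (n + 3) ++ seg (connBase klo khi y) 0 (connLen klo y) ++
      seg (connBase klo khi y + ((connLen klo y : ℕ) : ℤ) • ev 0) (Fin.last (n + 2))
        (y (Fin.last (n + 2)) - (khi (Fin.last (n + 2)) + 1)).toNat
  else combPath lo y (n + 3)

/-- The gauge contour runs from the corner to the site. [cite: Federbush1987PhaseCellIII, §5.3 3) p. 303] -/
theorem isPath_nicePath (hK : ∀ i, lo i < klo i ∧ klo i ≤ khi i ∧ khi i < hi i) {y : Site (n + 3)} (hy : y ∈ boxSites lo hi) :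
    IsPath lo y (nicePath lo klo khi y) := by
  unfold nicePath
  split_ifs with hsh
  · obtain ⟨hcol, hlev⟩ := hsh
    have hy0 : klo 0 ≤ y 0 + 1 := by have := (hcol 0 zero_ne_top).1; omega
    have hB : ∀ i, lo i ≤ connBase klo khi y i := fun i => by
      unfold connBase
      by_cases h0 : i = 0
      · rw [if_pos h0, h0]; have := hK 0; omega
      · rw [if_neg h0]
        by_cases hτ : i = Fin.last (n + 2)
        · rw [if_pos hτ, hτ]; have := hK (Fin.last (n + 2)); omega
        · rw [if_neg hτ]; exact (mem_boxSites.1 hy i).1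
    refine ((isPath_combPath_self hB).append (isPath_seg _ _ _)).append ?_
    have h := isPath_seg (connBase klo khi y + ((connLen klo y : ℕ) : ℤ) • ev 0) (Fin.last (n + 2))
      (y (Fin.last (n + 2)) - (khi (Fin.last (n + 2)) + 1)).toNat
    have hend : connBase klo khi y + ((connLen klo y : ℕ) : ℤ) • ev 0 +
        (((y (Fin.last (n + 2)) - (khi (Fin.last (n + 2)) + 1)).toNat : ℕ) : ℤ) • ev (Fin.last (n + 2)) = y := by
      rw [connBase_add_connLen hy0]
      funext i
      rw [add_smul_ev_apply, Int.toNat_of_nonneg (by omega)]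
      by_cases hi : i = Fin.last (n + 2)
      · rw [if_pos hi, if_pos hi, hi]; ring
      · rw [if_neg hi, if_neg hi, add_zero]
    rwa [hend] at h
  · exact isPath_combPath_self fun i => (mem_boxSites.1 hy i).1

/-- **Every bond of the gauge contour is a gauge bond.** [cite: Federbush1987PhaseCellIII, §5.3 3) p. 303] -/
theorem nicePath_subset (hK : ∀ i, lo i < klo i ∧ klo i ≤ khi i ∧ khi i < hi i) {y : Site (n + 3)}
    (hy : y ∈ boxSites lo hi) (hyK : y ∉ boxSites klo khi) :
    ∀ l ∈ nicePath lo klo khi y, l.1 ∈ niceTree lo hi klo khi := by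
  have hKτ := hK (Fin.last (n + 2))
  have hK0 := hK 0
  unfold nicePath
  split_ifs with hsh
  · obtain ⟨hcol, hlev⟩ := hsh
    have hy0 : klo 0 ≤ y 0 := (hcol 0 zero_ne_top).1
    have hy0' : y 0 ≤ khi 0 := (hcol 0 zero_ne_top).2
    have hBbox : connBase klo khi y ∈ boxSites lo hi := by
      rw [mem_boxSites]; intro i; unfold connBase
      by_cases h0 : i = 0
      · rw [if_pos h0, h0]; omega
      · rw [if_neg h0]
        by_cases hτ : i = Fin.last (n + 2)
        · rw [if_pos hτ, hτ]; omega
        · rw [if_neg hτ]; exact mem_boxSites.1 hy i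
    have hBoff : ¬ ColK klo khi (connBase klo khi y) := fun h => by
      have := (h 0 zero_ne_top).1; unfold connBase at this; rw [if_pos rfl] at this; omega
    intro l hl
    rw [List.mem_append, List.mem_append] at hl
    rcases hl with (hl | hl) | hl
    · -- the comb contour to the initial point of the chain
      exact comb_mem_niceTree (combPath_mem_punctured hK hBbox (Or.inl hBoff) l hl) (combPath_subset_combTree hBbox _ l hl)
    · -- the connector chain
      obtain ⟨t, ht, rfl⟩ := mem_seg.1 hl
      have hL : (connLen klo y : ℤ) = y 0 - klo 0 + 1 := by unfold connLen; exact Int.toNat_of_nonneg (by omega)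
      have htL : (t : ℤ) < y 0 - klo 0 + 1 := by rw [← hL]; exact_mod_cast ht
      -- coordinates of the two endpoints
      have hQ : ∀ i, (connBase klo khi y + (t : ℤ) • ev 0 : Site (n + 3)) i =
          if i = 0 then klo 0 - 1 + t else if i = Fin.last (n + 2) then khi (Fin.last (n + 2)) + 1 else y i := fun i => by
        rw [add_smul_ev_apply]; unfold connBase
        split_ifs <;> ring
      have hQ0 : (connBase klo khi y + (t : ℤ) • ev 0 : Site (n + 3)) 0 = klo 0 - 1 + t := by rw [hQ, if_pos rfl]
      have hQτ : (connBase klo khi y + (t : ℤ) • ev 0 : Site (n + 3)) (Fin.last (n + 2)) = khi (Fin.last (n + 2)) + 1 := by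
        rw [hQ, if_neg zero_ne_top.symm, if_pos rfl]
      have hQi : ∀ i, i ≠ 0 → i ≠ Fin.last (n + 2) → (connBase klo khi y + (t : ℤ) • ev 0 : Site (n + 3)) i = y i :=
        fun i h0 hτ => by rw [hQ, if_neg h0, if_neg hτ]
      have hconn : IsConn klo khi ((connBase klo khi y + (t : ℤ) • ev 0, 0) : Bond (n + 3)) := by
        refine ⟨rfl, hQτ, fun i hi => ?_⟩
        dsimp only
        by_cases h0 : i = 0
        · rw [h0, addE_self, hQ0]; omega
        · rw [addE_ne _ h0, hQi i h0 hi]; exact hcol i hi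
      refine conn_mem_niceTree ⟨⟨?_, ?_⟩, ?_, ?_⟩ hconn <;> dsimp only
      · rw [mem_boxSites]; intro i
        by_cases h0 : i = 0
        · rw [h0, hQ0]; omega
        · by_cases hτ : i = Fin.last (n + 2)
          · rw [hτ, hQτ]; omega
          · rw [hQi i h0 hτ]; exact mem_boxSites.1 hy i
      · rw [mem_boxSites]; intro i
        by_cases h0 : i = 0
        · rw [h0, addE_self, hQ0]; omega
        · rw [addE_ne _ h0]
          by_cases hτ : i = Fin.last (n + 2)
          · rw [hτ, hQτ]; omega
          · rw [hQi i h0 hτ]; exact mem_boxSites.1 hy i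
      · exact not_mem_hole_of_gt (by rw [hQτ]; omega)
      · exact not_mem_hole_of_gt (by rw [addE_ne _ zero_ne_top.symm, hQτ]; omega)
    · -- straight up the column
      obtain ⟨t, ht, rfl⟩ := mem_seg.1 hl
      rw [connBase_add_connLen (by omega)]
      have hm : (((y (Fin.last (n + 2)) - (khi (Fin.last (n + 2)) + 1)).toNat : ℕ) : ℤ) =
          y (Fin.last (n + 2)) - (khi (Fin.last (n + 2)) + 1) := Int.toNat_of_nonneg (by omega)
      have htm : (t : ℤ) < y (Fin.last (n + 2)) - (khi (Fin.last (n + 2)) + 1) := by rw [← hm]; exact_mod_cast ht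
      have hyτ := (mem_boxSites.1 hy (Fin.last (n + 2))).2
      have hR : ∀ i, ((fun i => if i = Fin.last (n + 2) then khi (Fin.last (n + 2)) + 1 else y i) +
          (t : ℤ) • ev (Fin.last (n + 2))) i = if i = Fin.last (n + 2) then khi (Fin.last (n + 2)) + 1 + t else y i := fun i => by
        rw [add_smul_ev_apply]; split_ifs <;> simp
      have hbox : (((fun i => if i = Fin.last (n + 2) then khi (Fin.last (n + 2)) + 1 else y i) +
          (t : ℤ) • ev (Fin.last (n + 2)), Fin.last (n + 2)) : Bond (n + 3)) ∈ boxBonds lo hi := by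
        refine ⟨?_, ?_⟩ <;> dsimp only <;> rw [mem_boxSites] <;> intro i
        · rw [hR]; by_cases hi : i = Fin.last (n + 2)
          · rw [if_pos hi, hi]; omega
          · rw [if_neg hi]; exact mem_boxSites.1 hy i
        · rw [add_ev_apply, hR]; by_cases hi : i = Fin.last (n + 2)
          · rw [if_pos hi, if_pos hi, hi]; omega
          · rw [if_neg hi, if_neg hi, add_zero]; exact mem_boxSites.1 hy i
      refine comb_mem_niceTree ⟨hbox, ?_, ?_⟩ (mem_combTree.2 ⟨hbox, fun ν hν => absurd (Fin.le_last ν) (not_le.2 hν)⟩) <;>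
        dsimp only
      · exact not_mem_hole_of_gt (by rw [hR, if_pos rfl]; omega)
      · exact not_mem_hole_of_gt (by rw [add_ev_apply, hR, if_pos rfl, if_pos rfl]; omega)
  · -- off the shadow: the comb contour itself
    have hoff : ¬ ColK klo khi y ∨ y (Fin.last (n + 2)) < klo (Fin.last (n + 2)) := by
      by_cases hc : ColK klo khi y
      · right
        have h1 : ¬ (klo (Fin.last (n + 2)) ≤ y (Fin.last (n + 2)) ∧ y (Fin.last (n + 2)) ≤ khi (Fin.last (n + 2))) :=
          fun h => hyK (mem_hole_iff.2 ⟨hc, h⟩)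
        have h2 : ¬ khi (Fin.last (n + 2)) < y (Fin.last (n + 2)) := fun h => hsh ⟨hc, h⟩
        omega
      · exact Or.inl hc
    exact fun l hl => comb_mem_niceTree (combPath_mem_punctured hK hy hoff l hl) (combPath_subset_combTree hy _ l hl)

/-- The initial point of an oriented bond over the punctured block is a site of the box off the hole.
[cite: Federbush1987PhaseCellIII, §5.3 1) p. 303] -/
theorem src_mem_of_punctured {l : Letter (n + 3)} (hl : l.1 ∈ puncturedBonds lo hi klo khi) :
    src l ∈ boxSites lo hi ∧ src l ∉ boxSites klo khi := by
  rcases l with ⟨b, _ | _⟩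
  · exact ⟨hl.1.2, hl.2.2⟩
  · exact ⟨hl.1.1, hl.2.1⟩

/-- **The extended axial gauge SPANS the punctured block from the corner** (p32's `Spans`): «a maximal tree».
[cite: Federbush1987PhaseCellIII, §5.3 2)–3) p. 303] -/
theorem spans_niceTree (hK : ∀ i, lo i < klo i ∧ klo i ≤ khi i ∧ khi i < hi i) :
    Spans (niceTree lo hi klo khi) (puncturedBonds lo hi klo khi) lo := fun l hl =>
  ⟨nicePath lo klo khi (src l), isPath_nicePath hK (src_mem_of_punctured hl).1,
    nicePath_subset hK (src_mem_of_punctured hl).1 (src_mem_of_punctured hl).2⟩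

variable {G : Type*} [Group G]

/-- **The nice-block axial gauge is a COMPLETE gauge fixing**: two based gauge transformations (`= ε` at the corner) carrying `u` to `ε`
on the gauge bonds agree at every endpoint of every bond of the punctured block. [cite: Federbush1987PhaseCellIII, §5.3 2)–3) p. 303] -/
theorem niceGauge_unique (hK : ∀ i, lo i < klo i ∧ klo i ≤ khi i ∧ khi i < hi i) (h h' : Site (n + 3) → G)
    (u : Bond (n + 3) → G) (h1 : h lo = 1) (h1' : h' lo = 1) (hT : ∀ b ∈ niceTree lo hi klo khi, gaugeAct h u b = 1)
    (hT' : ∀ b ∈ niceTree lo hi klo khi, gaugeAct h' u b = 1) :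
    ∀ l : Letter (n + 3), l.1 ∈ puncturedBonds lo hi klo khi → h (src l) = h' (src l) := by
  intro l hl
  obtain ⟨w, hw, hwT⟩ := spans_niceTree hK l hl
  rw [eq_mul_wordHol_of_gaugeAct_eq_one h u hT hw hwT, eq_mul_wordHol_of_gaugeAct_eq_one h' u hT' hw hwT, h1, h1']

/-- Consequently two based gauge transformations into the nice-block axial gauge produce the same configuration on the punctured
block (so `niceFn` is THE gauge fixing). [cite: Federbush1987PhaseCellIII, §5.3 2)–3) p. 303] -/
theorem gaugeAct_eq_of_niceGauge (hK : ∀ i, lo i < klo i ∧ klo i ≤ khi i ∧ khi i < hi i) (h h' : Site (n + 3) → G)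
    (u : Bond (n + 3) → G) (h1 : h lo = 1) (h1' : h' lo = 1) (hT : ∀ b ∈ niceTree lo hi klo khi, gaugeAct h u b = 1)
    (hT' : ∀ b ∈ niceTree lo hi klo khi, gaugeAct h' u b = 1) :
    ∀ b ∈ puncturedBonds lo hi klo khi, gaugeAct h u b = gaugeAct h' u b := by
  intro b hb
  rw [gaugeAct_apply, gaugeAct_apply]
  have hs := niceGauge_unique hK h h' u h1 h1' hT hT' (b, true) hb
  have ht := niceGauge_unique hK h h' u h1 h1' hT hT' (b, false) hb
  rw [src_true] at hs
  rw [src_false] at ht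
  rw [hs, ht]

end Spanning

/-! ## §10 (v1.1) Lipschitz determination on the nice block, every group with a bi-invariant metric -/

section Lipschitz

variable {lo hi klo khi : Site (n + 3)}
variable {G : Type*} [Group G] [MetricSpace G] [IsIsometricSMul G G] [IsIsometricSMul Gᵐᵒᵖ G]

/-- **The bond variables of the nice block are LIPSCHITZ in its plaquette variables** (in the extended axial gauge, every group with a
bi-invariant metric, no small field): `d(u_b, u′_b) ≦ ((3^{niceRank(b)+1} − 1)/2) · α` — a constant depending only on the block («we may
choose the constants … by maximizing or minimizing over a finite set», p. 303), by `PeelingEstimate`'s `Peeling.dist_le_pow_rank`.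
[cite: Federbush1987PhaseCellIII, §5.3 p. 303, 2)–5)] -/
theorem dist_le_of_niceGauge (hK : ∀ i, lo i < klo i ∧ klo i ≤ khi i ∧ khi i < hi i) (u u' : Bond (n + 3) → G)
    (hg : ∀ b ∈ niceTree lo hi klo khi, u b = 1) (hg' : ∀ b ∈ niceTree lo hi klo khi, u' b = 1) {α : ℝ} (hα : 0 ≤ α)
    (hplaq : ∀ p ∈ puncturedPlaq lo hi klo khi,
      dist (wordHol u (plaqLoop p.1 p.2.1 p.2.2)) (wordHol u' (plaqLoop p.1 p.2.1 p.2.2)) ≤ α) :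
    ∀ b ∈ puncturedBonds lo hi klo khi,
      dist (u b) (u' b) ≤ ((3 : ℝ) ^ (niceRank lo hi klo khi b + 1) - 1) / 2 * α :=
  (nicePeeling hK).dist_le_pow_rank u u' hg hg' hα hplaq

/-- The same with `u′ ≡ ε`: small plaquette variables on the nice block force small bond variables in the extended axial gauge («In this
gauge we deduce an inequality like (5.24)», step 5)). [cite: Federbush1987PhaseCellIII, §5.3 5) p. 304, 2)–3) p. 303] -/
theorem absG_le_of_niceGauge (hK : ∀ i, lo i < klo i ∧ klo i ≤ khi i ∧ khi i < hi i) (u : Bond (n + 3) → G)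
    (hg : ∀ b ∈ niceTree lo hi klo khi, u b = 1) {α : ℝ} (hα : 0 ≤ α)
    (hplaq : ∀ p ∈ puncturedPlaq lo hi klo khi, absG (wordHol u (plaqLoop p.1 p.2.1 p.2.2)) ≤ α) :
    ∀ b ∈ puncturedBonds lo hi klo khi, absG (u b) ≤ ((3 : ℝ) ^ (niceRank lo hi klo khi b + 1) - 1) / 2 * α :=
  (nicePeeling hK).absG_le_pow_rank u hg hα hplaq

end Lipschitz

end PuncturedBlockPeeling

end Literature.MathematicalPhysics.QuantumFieldTheory.Federbush1986
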